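import Summits.Parity.GeneralizedHardyLittlewood.Theorems.GreenTaoLevelTwoMNTwoDualApproximation
import Summits.Parity.GeneralizedHardyLittlewood.Theorems.GreenTaoLevelTwoGITwoCyclicInversePhaseLipschitz

/-!
# Route `GreenTaoLevelTwo`, crux `MNTwo` (stmt-Parity-21276), line `birth`, stub `stub_mnVertical`:
# approximate linearity ⇒ approximate `U²`-duality (GT 2008b Prop. 15, the three-term identity)

Brick for block V2 of the `stub_mnVertical` census (B. Green, T. Tao, *Quadratic uniformity of the
Möbius function*, Ann. Inst. Fourier 58 (2008) = arXiv:math/0606087, §6, proof of Prop. 15: "Summing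
these three bounds yields `φ(x) = φ(x+h₁+h₂) − φ(n_s+h₁) − φ(n_s+h₂) + 2φ(n_s) + O_{ℝ/ℤ}(ε)` … From the
Lipschitz assumption on `ψ` … `f(x) = f(x+h₁+h₂) F(h₁) F(h₂) e(−2φ(n_s)) + O(ε + κ)`").  Def-free,
abstract form feeding the hypothesis `happrox` of `…MNTwoDualApproximation.norm_sum_le_of_approx_dual`:
with `f = ψ · e(−φ)`, `F(h) = e(φ(n_s+h))`, `c = e(−2φ(n_s))`,
`‖a(x)f(x) − c·a(x)F(h₁)F(h₂)f(x+h₁+h₂)‖ ≤ ‖a(x)‖ (2π ε ψ(x) + κ(x))`.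

* `norm_weight_phase_sub_le` — the pointwise estimate.

References: [GreenTao2008QuadraticMobius] arXiv:math/0606087 §6, proof of Proposition 15.
-/

noncomputable section

namespace Summit.Parity.GeneralizedHardyLittlewood.GreenTaoLevelTwoMNTwoApproxLinear

open Finset
open Summit.Parity.GeneralizedHardyLittlewood.GreenTaoLevelTwoGITwoCyclicInverse (norm_toCircle_sub_toCircle_le)

variable {N : ℕ}

/-- **Approximate linearity ⇒ approximate `U²`-duality, pointwise (GT 2008b, proof of Prop. 15).**
Let `φ : ℤ/Nℤ → ℝ/ℤ`, `0 ≤ ψ`, and suppose that whenever `ψ(x) ≠ 0`,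
`‖φ(x) − φ(x+h₁+h₂) + φ(n_s+h₁) + φ(n_s+h₂) − 2φ(n_s)‖_{ℝ/ℤ} ≤ ε` for `h₁, h₂ ∈ A`, and
`|ψ(x+h₁+h₂) − ψ(x)| ≤ κ(x)`.  Then with `f = ψ·e(−φ)`, `F(h) = e(φ(n_s+h))`, `c = e(−2φ(n_s))`:
`‖a(x)f(x) − c·(a(x)F(h₁)F(h₂)f(x+h₁+h₂))‖ ≤ ‖a(x)‖(2πεψ(x) + κ(x))`.
[cite: GreenTao2008QuadraticMobius, proof of Proposition 15] -/
theorem norm_weight_phase_sub_le (φ : ZMod N → UnitAddCircle) (ψ κ : ZMod N → ℝ) (a : ZMod N → ℂ)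
    (A : Finset (ZMod N)) (nₛ : ZMod N) {ε : ℝ} (hψ0 : ∀ x, 0 ≤ ψ x)
    (hφ : ∀ x, ψ x ≠ 0 → ∀ h₁ ∈ A, ∀ h₂ ∈ A,
      ‖φ x - φ (x + h₁ + h₂) + φ (nₛ + h₁) + φ (nₛ + h₂) - 2 • φ nₛ‖ ≤ ε)
    (hψ : ∀ x, ∀ h₁ ∈ A, ∀ h₂ ∈ A, |ψ (x + h₁ + h₂) - ψ x| ≤ κ x)
    (x : ZMod N) {h₁ h₂ : ZMod N} (hh₁ : h₁ ∈ A) (hh₂ : h₂ ∈ A) :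
    ‖a x * ((ψ x : ℂ) * ((AddCircle.toCircle (-φ x) : Circle) : ℂ)) -
        ((AddCircle.toCircle (-(2 • φ nₛ)) : Circle) : ℂ) *
          (a x * ((AddCircle.toCircle (φ (nₛ + h₁)) : Circle) : ℂ) *
            ((AddCircle.toCircle (φ (nₛ + h₂)) : Circle) : ℂ) *
            ((ψ (x + h₁ + h₂) : ℂ) * ((AddCircle.toCircle (-φ (x + h₁ + h₂)) : Circle) : ℂ)))‖ ≤
      ‖a x‖ * (2 * Real.pi * ε * ψ x + κ x) := by
  -- the combined phase `Φ = φ(x+h₁+h₂) − φ(nₛ+h₁) − φ(nₛ+h₂) + 2φ(nₛ)`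
  set Φ : UnitAddCircle := φ (x + h₁ + h₂) - φ (nₛ + h₁) - φ (nₛ + h₂) + 2 • φ nₛ with hΦ
  have hprod : ((AddCircle.toCircle (-(2 • φ nₛ)) : Circle) : ℂ) *
      (((AddCircle.toCircle (φ (nₛ + h₁)) : Circle) : ℂ) * ((AddCircle.toCircle (φ (nₛ + h₂)) : Circle) : ℂ) *
        ((AddCircle.toCircle (-φ (x + h₁ + h₂)) : Circle) : ℂ)) =
      ((AddCircle.toCircle (-Φ) : Circle) : ℂ) := by
    rw [← Circle.coe_mul, ← Circle.coe_mul, ← Circle.coe_mul, ← AddCircle.toCircle_add,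
      ← AddCircle.toCircle_add, ← AddCircle.toCircle_add]
    congr 2
    rw [hΦ]; abel
  -- rewrite the difference
  have e : a x * ((ψ x : ℂ) * ((AddCircle.toCircle (-φ x) : Circle) : ℂ)) -
      ((AddCircle.toCircle (-(2 • φ nₛ)) : Circle) : ℂ) *
        (a x * ((AddCircle.toCircle (φ (nₛ + h₁)) : Circle) : ℂ) *
          ((AddCircle.toCircle (φ (nₛ + h₂)) : Circle) : ℂ) *
          ((ψ (x + h₁ + h₂) : ℂ) * ((AddCircle.toCircle (-φ (x + h₁ + h₂)) : Circle) : ℂ))) =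
      a x * ((ψ x : ℂ) * (((AddCircle.toCircle (-φ x) : Circle) : ℂ) -
          ((AddCircle.toCircle (-Φ) : Circle) : ℂ)) +
        ((ψ x - ψ (x + h₁ + h₂) : ℝ) : ℂ) * ((AddCircle.toCircle (-Φ) : Circle) : ℂ)) := by
    rw [← hprod]; push_cast; ring
  rw [e, norm_mul]
  refine mul_le_mul_of_nonneg_left ?_ (norm_nonneg _)
  -- the two error terms
  have hcirc : ‖((AddCircle.toCircle (-Φ) : Circle) : ℂ)‖ = 1 := Circle.norm_coe _
  have h2 : ‖((ψ x - ψ (x + h₁ + h₂) : ℝ) : ℂ) * ((AddCircle.toCircle (-Φ) : Circle) : ℂ)‖ ≤ κ x := by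
    rw [norm_mul, hcirc, mul_one, Complex.norm_real, Real.norm_eq_abs, abs_sub_comm]
    exact hψ x h₁ hh₁ h₂ hh₂
  have h1 : ‖(ψ x : ℂ) * (((AddCircle.toCircle (-φ x) : Circle) : ℂ) -
      ((AddCircle.toCircle (-Φ) : Circle) : ℂ))‖ ≤ 2 * Real.pi * ε * ψ x := by
    by_cases hz : ψ x = 0
    · rw [hz]; simp
    · rw [norm_mul, Complex.norm_real, Real.norm_eq_abs, abs_of_nonneg (hψ0 x)]
      have h3 := norm_toCircle_sub_toCircle_le (-φ x) (-Φ)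
      have h4 : ‖-φ x - -Φ‖ ≤ ε := by
        have e2 : -φ x - -Φ = -(φ x - φ (x + h₁ + h₂) + φ (nₛ + h₁) + φ (nₛ + h₂) - 2 • φ nₛ) := by
          rw [hΦ]; abel
        rw [e2, norm_neg]
        exact hφ x hz h₁ hh₁ h₂ hh₂
      calc ψ x * ‖((AddCircle.toCircle (-φ x) : Circle) : ℂ) - ((AddCircle.toCircle (-Φ) : Circle) : ℂ)‖
          ≤ ψ x * (2 * Real.pi * ε) := by
            refine mul_le_mul_of_nonneg_left (h3.trans ?_) (hψ0 x)
            exact mul_le_mul_of_nonneg_left h4 (by positivity)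
        _ = 2 * Real.pi * ε * ψ x := by ring
  calc ‖(ψ x : ℂ) * (((AddCircle.toCircle (-φ x) : Circle) : ℂ) - ((AddCircle.toCircle (-Φ) : Circle) : ℂ)) +
        ((ψ x - ψ (x + h₁ + h₂) : ℝ) : ℂ) * ((AddCircle.toCircle (-Φ) : Circle) : ℂ)‖
      ≤ ‖(ψ x : ℂ) * (((AddCircle.toCircle (-φ x) : Circle) : ℂ) - ((AddCircle.toCircle (-Φ) : Circle) : ℂ))‖ +
        ‖((ψ x - ψ (x + h₁ + h₂) : ℝ) : ℂ) * ((AddCircle.toCircle (-Φ) : Circle) : ℂ)‖ := norm_add_le _ _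
    _ ≤ 2 * Real.pi * ε * ψ x + κ x := add_le_add h1 h2

end Summit.Parity.GeneralizedHardyLittlewood.GreenTaoLevelTwoMNTwoApproxLinear
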